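import Summits.Parity.GeneralizedHardyLittlewood.Theorems.PrimeLevelFamEdgeMomentsBeyondDiagonalDiagRemThreeThreeMonomials
import HarnessLib

/-!
# Route `PrimeLevelFamEdge`, crux K_A `MomentsBeyondDiagonal` (stmt-Parity-20007), line «petersson_layers» v4, stub `stub_diag`:
# **the monomial bookkeeping of the order-`(4,4)` remainder weight, PART B (kernels `r_ab` with `a = 1`)** (brick B3 of (R₄₄), abstract form)

Brick B3 of (R₄₄) — the hypothesis `hR` of `…DiagOrderFourFourOfR44.orderFourFour_target_of_remainder` (p839686). For fixed Selberg
coordinates `(c,g)` the Hecke-summed remainder weight of order `(4,4)` is a combination of the twenty-five kernels `r_ab(αk₁k₂)`, `a, b ≤ 4`,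
with polynomial prefactors in `L = 2β + ℓ⁺(k₁) + ℓ⁺(k₂)` and the central moments `S₂, 3S₂²−2S₄, 15S₂³−30S₂S₄+16S₆,
105S₂⁴−420S₂²S₄+448S₂S₆+140S₄²−272S₈` (`S_m = Pm(k₁) + Pm(k₂)`) of homogeneous weight `8` — the order-`(4,4)` twin of
`…DiagRemTwoFourMonomials` (p837449); for the 400-line rule the 139-term weight is cut into three kernel groups (parts A `a = 0`, B `a = 1`,
C `a ≥ 2`; the combination is `…DiagRemFourFourMonomials.abs_monomial_weight_le₄₄`). In the PRODUCT basis `m_r(k₁)m_s(k₂)` this part is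
`33` terms; by `…DiagRemTwoTwoLpow.abs_Lpow_monomial_le` each costs `|c|(4Λ)ᵖ` times the envelope of its decoration type (undecorated `Ψ₀`,
one-sided `P2` `Ψ₂`, `3P2²−2P4` `Ψ₄`, `15P2³−…` `Ψ₆`, `105P2⁴−…−272P8` `Ψ₈`, both-sided `P2⊗P2` `Ψ_B`, `P2⊗(3P2²−2P4)` `Ψ_BD`,
`P2⊗(15P2³−…)` `Ψ_BS`, `(3P2²−2P4)⊗(3P2²−2P4)` `Ψ_DD`; the family hypotheses range over ALL kernels of the order carrying that type, so the
three parts share them); row decorations are moved to the column by `sum_swap_decor_Lpow` / `sum_swap_both_Lpow`.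

* `abs_monomial_weight_le₄₄B` — **one profile monomial `ℓ⁺(k₁)^{m₁}ℓ⁺(k₂)^{m₂}` against this part of `Wt₄₄`: `≤ (2592 · Λ ^ 8 · Ψ₀ + 780 · Λ ^ 6 · Ψ₂ + 44 · Λ ^ 4 · Ψ₄ + Λ ^ 2 · Ψ₆ + 132 · Λ ^ 4 · ΨB + 12 · Λ ^ 2 · ΨBD)·log^{m₁+m₂}Y`**
  (constants `⌈Σ|c|4ᵖ⌉` of this part).

Def-free; theorems only. Helper `--supports stmt-Parity-20007`; closes nothing; K_A, K_B and the Parity summit are NOT proved; nothing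
about Landau–Siegel zeros.

## References
* E. Kowalski, P. Michel, J. VanderKam, J. reine angew. Math. 526 (2000), (22)–(28) pp. 12–15 and Prop. 5.1 p. 18.
  [cite: KowalskiMichelVanderKam2000, (23)–(28) — derivation (order-(4,4) remainder weight, monomial bookkeeping)]
-/

noncomputable section

open Finset Real Polynomial

namespace Summit.Parity.GeneralizedHardyLittlewood.Theorems.MomentsBeyondDiagonal.DiagCorner

open Summit.Parity.GeneralizedHardyLittlewood.Theorems.BeyondDiagonalBeatsQuarter.Corner

set_option maxHeartbeats 8000000 in
set_option maxRecDepth 16384 in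
-- 33 monomial bounds combined by `linarith`
/-- **One monomial `ℓ⁺(k₁)^{m₁}ℓ⁺(k₂)^{m₂}` (`m₁, m₂ ≥ 1`) against part B of the order-`(4,4)` remainder weight** (module docstring).
[cite: KowalskiMichelVanderKam2000, (23)–(28) — derivation (order-(4,4) remainder weight, one monomial)] -/
theorem abs_monomial_weight_le₄₄B {a P2 P4 P6 : ℕ → ℝ}
    {R₀₀ R₀₁ R₀₂ R₀₃ R₀₄ R₁₀ R₁₁ R₁₂ R₁₃ R₁₄ R₂₀ R₂₁ R₂₂ R₂₃ R₂₄ R₃₀ R₃₁ R₃₂ R₃₃ R₃₄ R₄₀ R₄₁ R₄₂ R₄₃ R₄₄ : ℝ → ℝ}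
    {Y α β Λ Ψ₀ Ψ₂ Ψ₄ Ψ₆ ΨB ΨBD : ℝ} {m₁ m₂ : ℕ}
    (hm₁ : 1 ≤ m₁) (hm₂ : 1 ≤ m₂) (hY : 1 ≤ Y) (hΛ : 1 ≤ Λ) (hβ : |β| ≤ Λ) (hLY : Real.log Y ≤ Λ)
    (hΨ₀ : 0 ≤ Ψ₀) (hΨ₂ : 0 ≤ Ψ₂) (hΨ₄ : 0 ≤ Ψ₄) (hΨ₆ : 0 ≤ Ψ₆) (hΨB : 0 ≤ ΨB) (hΨBD : 0 ≤ ΨBD)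
    (h0 : ∀ R : ℝ → ℝ, (R = R₀₀ ∨ R = R₀₁ ∨ R = R₀₂ ∨ R = R₀₃ ∨ R = R₀₄ ∨ R = R₁₀ ∨ R = R₁₁ ∨ R = R₁₂ ∨ R = R₁₃ ∨ R = R₁₄ ∨ R = R₂₀ ∨ R = R₂₁ ∨ R = R₂₂ ∨ R = R₂₃ ∨ R = R₂₄ ∨ R = R₃₀ ∨ R = R₃₁ ∨ R = R₃₂ ∨ R = R₃₃ ∨ R = R₃₄ ∨ R = R₄₀ ∨ R = R₄₁ ∨ R = R₄₂ ∨ R = R₄₃ ∨ R = R₄₄) →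
      ∀ i j : ℕ, 1 ≤ i → 1 ≤ j →
      |∑ k₁ ∈ Icc 1 ⌊Y⌋₊, ∑ k₂ ∈ Icc 1 ⌊Y⌋₊,
          a k₁ * a k₂ * ellp Y k₁ ^ i * ellp Y k₂ ^ j * R (α * k₁ * k₂)| ≤ Real.log Y ^ (i + j) * Ψ₀)
    (h2 : ∀ R : ℝ → ℝ, (R = R₀₀ ∨ R = R₀₁ ∨ R = R₀₂ ∨ R = R₀₃ ∨ R = R₀₄ ∨ R = R₁₀ ∨ R = R₁₁ ∨ R = R₁₂ ∨ R = R₁₄ ∨ R = R₂₀ ∨ R = R₂₁ ∨ R = R₂₂ ∨ R = R₂₃ ∨ R = R₂₄ ∨ R = R₃₀ ∨ R = R₃₂ ∨ R = R₃₃ ∨ R = R₄₀ ∨ R = R₄₁ ∨ R = R₄₂) →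
      ∀ i j : ℕ, 1 ≤ i → 1 ≤ j →
      |∑ k₁ ∈ Icc 1 ⌊Y⌋₊, ∑ k₂ ∈ Icc 1 ⌊Y⌋₊,
          a k₁ * (a k₂ * P2 k₂) * ellp Y k₁ ^ i * ellp Y k₂ ^ j * R (α * k₁ * k₂)| ≤ Real.log Y ^ (i + j) * Ψ₂)
    (h4 : ∀ R : ℝ → ℝ, (R = R₀₀ ∨ R = R₀₁ ∨ R = R₀₂ ∨ R = R₀₃ ∨ R = R₀₄ ∨ R = R₁₀ ∨ R = R₁₁ ∨ R = R₁₂ ∨ R = R₁₃ ∨ R = R₂₀ ∨ R = R₂₁ ∨ R = R₂₂ ∨ R = R₃₀ ∨ R = R₃₁ ∨ R = R₄₀) →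
      ∀ i j : ℕ, 1 ≤ i → 1 ≤ j →
      |∑ k₁ ∈ Icc 1 ⌊Y⌋₊, ∑ k₂ ∈ Icc 1 ⌊Y⌋₊,
          a k₁ * (a k₂ * (3 * P2 k₂ ^ 2 - 2 * P4 k₂)) * ellp Y k₁ ^ i * ellp Y k₂ ^ j * R (α * k₁ * k₂)| ≤ Real.log Y ^ (i + j) * Ψ₄)
    (h6 : ∀ R : ℝ → ℝ, (R = R₀₀ ∨ R = R₀₁ ∨ R = R₀₂ ∨ R = R₁₀ ∨ R = R₁₁ ∨ R = R₂₀) →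
      ∀ i j : ℕ, 1 ≤ i → 1 ≤ j →
      |∑ k₁ ∈ Icc 1 ⌊Y⌋₊, ∑ k₂ ∈ Icc 1 ⌊Y⌋₊,
          a k₁ * (a k₂ * (15 * P2 k₂ ^ 3 - 30 * P2 k₂ * P4 k₂ + 16 * P6 k₂)) * ellp Y k₁ ^ i * ellp Y k₂ ^ j * R (α * k₁ * k₂)| ≤ Real.log Y ^ (i + j) * Ψ₆)
    (hB : ∀ R : ℝ → ℝ, (R = R₀₀ ∨ R = R₀₁ ∨ R = R₀₂ ∨ R = R₀₃ ∨ R = R₀₄ ∨ R = R₁₀ ∨ R = R₁₁ ∨ R = R₁₂ ∨ R = R₁₃ ∨ R = R₂₀ ∨ R = R₂₁ ∨ R = R₂₂ ∨ R = R₃₀ ∨ R = R₃₁ ∨ R = R₄₀) →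
      ∀ i j : ℕ, 1 ≤ i → 1 ≤ j →
      |∑ k₁ ∈ Icc 1 ⌊Y⌋₊, ∑ k₂ ∈ Icc 1 ⌊Y⌋₊,
          (a k₁ * P2 k₁) * (a k₂ * P2 k₂) * ellp Y k₁ ^ i * ellp Y k₂ ^ j * R (α * k₁ * k₂)| ≤ Real.log Y ^ (i + j) * ΨB)
    (hBD : ∀ R : ℝ → ℝ, (R = R₀₀ ∨ R = R₀₁ ∨ R = R₀₂ ∨ R = R₁₀ ∨ R = R₁₁ ∨ R = R₂₀) →
      ∀ i j : ℕ, 1 ≤ i → 1 ≤ j →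
      |∑ k₁ ∈ Icc 1 ⌊Y⌋₊, ∑ k₂ ∈ Icc 1 ⌊Y⌋₊,
          (a k₁ * P2 k₁) * (a k₂ * (3 * P2 k₂ ^ 2 - 2 * P4 k₂)) * ellp Y k₁ ^ i * ellp Y k₂ ^ j * R (α * k₁ * k₂)| ≤ Real.log Y ^ (i + j) * ΨBD) :
    |∑ k₁ ∈ Icc 1 ⌊Y⌋₊, ∑ k₂ ∈ Icc 1 ⌊Y⌋₊,
        a k₁ * a k₂ * ellp Y k₁ ^ m₁ * ellp Y k₂ ^ m₂ *
          (((2 * β + ellp Y k₁ + ellp Y k₂) ^ 7 - 3 * (2 * β + ellp Y k₁ + ellp Y k₂) ^ 5 * (P2 k₁ + P2 k₂) + 9 * (2 * β + ellp Y k₁ + ellp Y k₂) ^ 3 * (P2 k₁ + P2 k₂) ^ 2 - 15 * (2 * β + ellp Y k₁ + ellp Y k₂) * (P2 k₁ + P2 k₂) ^ 3 - 6 * (2 * β + ellp Y k₁ + ellp Y k₂) ^ 3 * (P4 k₁ + P4 k₂) + 30 * (2 * β + ellp Y k₁ + ellp Y k₂) * (P2 k₁ + P2 k₂) * (P4 k₁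 + P4 k₂) - 16 * (2 * β + ellp Y k₁ + ellp Y k₂) * (P6 k₁ + P6 k₂)) / 32 * R₁₀ (α * k₁ * k₂) +
            ((2 * β + ellp Y k₁ + ellp Y k₂) ^ 6 - 3 * (2 * β + ellp Y k₁ + ellp Y k₂) ^ 4 * (P2 k₁ + P2 k₂) + 9 * (2 * β + ellp Y k₁ + ellp Y k₂) ^ 2 * (P2 k₁ + P2 k₂) ^ 2 - 6 * (2 * β + ellp Y k₁ + ellp Y k₂) ^ 2 * (P4 k₁ + P4 k₂) - 15 * (P2 k₁ + P2 k₂) ^ 3 + 30 * (P2 k₁ + P2 k₂) * (P4 k₁ + P4 k₂) - 16 * (P6 k₁ + P6 k₂)) / 4 * R₁₁ (α * k₁ * k₂) +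
            (3 * (2 * β + ellp Y k₁ + ellp Y k₂) ^ 5 - 6 * (2 * β + ellp Y k₁ + ellp Y k₂) ^ 3 * (P2 k₁ + P2 k₂) + 9 * (2 * β + ellp Y k₁ + ellp Y k₂) * (P2 k₁ + P2 k₂) ^ 2 - 6 * (2 * β + ellp Y k₁ + ellp Y k₂) * (P4 k₁ + P4 k₂)) / 4 * R₁₂ (α * k₁ * k₂) +
            ((2 * β + ellp Y k₁ + ellp Y k₂) ^ 4 - 3 * (P2 k₁ + P2 k₂) ^ 2 + 2 * (P4 k₁ + P4 k₂)) * R₁₃ (α * k₁ * k₂) +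
            ((2 * β + ellp Y k₁ + ellp Y k₂) ^ 3 + 3 * (2 * β + ellp Y k₁ + ellp Y k₂) * (P2 k₁ + P2 k₂)) / 2 * R₁₄ (α * k₁ * k₂))| ≤
      (2592 * Λ ^ 8 * Ψ₀ + 780 * Λ ^ 6 * Ψ₂ + 44 * Λ ^ 4 * Ψ₄ + Λ ^ 2 * Ψ₆ + 132 * Λ ^ 4 * ΨB + 12 * Λ ^ 2 * ΨBD) * Real.log Y ^ (m₁ + m₂) := by
  have hL0 : 0 ≤ Real.log Y := Real.log_nonneg hY
  have hΛ0 : 0 ≤ Λ := zero_le_one.trans hΛ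
  set I := Icc 1 ⌊Y⌋₊ with hI
  set X₀ : ℝ := Real.log Y ^ (m₁ + m₂) * Ψ₀ with hX₀
  set X₂ : ℝ := Real.log Y ^ (m₁ + m₂) * Ψ₂ with hX₂
  set X₄ : ℝ := Real.log Y ^ (m₁ + m₂) * Ψ₄ with hX₄
  set X₆ : ℝ := Real.log Y ^ (m₁ + m₂) * Ψ₆ with hX₆
  set XB : ℝ := Real.log Y ^ (m₁ + m₂) * ΨB with hXB
  set XBD : ℝ := Real.log Y ^ (m₁ + m₂) * ΨBD with hXBD
  have hX₀0 : 0 ≤ X₀ := by positivity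
  have hX₂0 : 0 ≤ X₂ := by positivity
  have hX₄0 : 0 ≤ X₄ := by positivity
  have hX₆0 : 0 ≤ X₆ := by positivity
  have hXB0 : 0 ≤ XB := by positivity
  have hXBD0 : 0 ≤ XBD := by positivity
  have U10 := abs_Lpow_monomial_le hY hΛ hβ hLY hΨ₀ (h0 R₁₀ (Or.inr (Or.inr (Or.inr (Or.inr (Or.inr (Or.inl rfl)))))))
  have U11 := abs_Lpow_monomial_le hY hΛ hβ hLY hΨ₀ (h0 R₁₁ (Or.inr (Or.inr (Or.inr (Or.inr (Or.inr (Or.inr (Or.inl rfl))))))))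
  have U12 := abs_Lpow_monomial_le hY hΛ hβ hLY hΨ₀ (h0 R₁₂ (Or.inr (Or.inr (Or.inr (Or.inr (Or.inr (Or.inr (Or.inr (Or.inl rfl)))))))))
  have U13 := abs_Lpow_monomial_le hY hΛ hβ hLY hΨ₀ (h0 R₁₃ (Or.inr (Or.inr (Or.inr (Or.inr (Or.inr (Or.inr (Or.inr (Or.inr (Or.inl rfl))))))))))
  have U14 := abs_Lpow_monomial_le hY hΛ hβ hLY hΨ₀ (h0 R₁₄ (Or.inr (Or.inr (Or.inr (Or.inr (Or.inr (Or.inr (Or.inr (Or.inr (Or.inr (Or.inl rfl)))))))))))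
  have C210 := abs_Lpow_monomial_le hY hΛ hβ hLY hΨ₂ (h2 R₁₀ (Or.inr (Or.inr (Or.inr (Or.inr (Or.inr (Or.inl rfl)))))))
  have C211 := abs_Lpow_monomial_le hY hΛ hβ hLY hΨ₂ (h2 R₁₁ (Or.inr (Or.inr (Or.inr (Or.inr (Or.inr (Or.inr (Or.inl rfl))))))))
  have C212 := abs_Lpow_monomial_le hY hΛ hβ hLY hΨ₂ (h2 R₁₂ (Or.inr (Or.inr (Or.inr (Or.inr (Or.inr (Or.inr (Or.inr (Or.inl rfl)))))))))
  have C214 := abs_Lpow_monomial_le hY hΛ hβ hLY hΨ₂ (h2 R₁₄ (Or.inr (Or.inr (Or.inr (Or.inr (Or.inr (Or.inr (Or.inr (Or.inr (Or.inl rfl))))))))))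
  have C410 := abs_Lpow_monomial_le hY hΛ hβ hLY hΨ₄ (h4 R₁₀ (Or.inr (Or.inr (Or.inr (Or.inr (Or.inr (Or.inl rfl)))))))
  have C411 := abs_Lpow_monomial_le hY hΛ hβ hLY hΨ₄ (h4 R₁₁ (Or.inr (Or.inr (Or.inr (Or.inr (Or.inr (Or.inr (Or.inl rfl))))))))
  have C412 := abs_Lpow_monomial_le hY hΛ hβ hLY hΨ₄ (h4 R₁₂ (Or.inr (Or.inr (Or.inr (Or.inr (Or.inr (Or.inr (Or.inr (Or.inl rfl)))))))))
  have C413 := abs_Lpow_monomial_le hY hΛ hβ hLY hΨ₄ (h4 R₁₃ (Or.inr (Or.inr (Or.inr (Or.inr (Or.inr (Or.inr (Or.inr (Or.inr (Or.inl rfl))))))))))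
  have C610 := abs_Lpow_monomial_le hY hΛ hβ hLY hΨ₆ (h6 R₁₀ (Or.inr (Or.inr (Or.inr (Or.inl rfl)))))
  have C611 := abs_Lpow_monomial_le hY hΛ hβ hLY hΨ₆ (h6 R₁₁ (Or.inr (Or.inr (Or.inr (Or.inr (Or.inl rfl))))))
  have B2210 := abs_Lpow_monomial_le hY hΛ hβ hLY hΨB (hB R₁₀ (Or.inr (Or.inr (Or.inr (Or.inr (Or.inr (Or.inl rfl)))))))
  have B2211 := abs_Lpow_monomial_le hY hΛ hβ hLY hΨB (hB R₁₁ (Or.inr (Or.inr (Or.inr (Or.inr (Or.inr (Or.inr (Or.inl rfl))))))))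
  have B2212 := abs_Lpow_monomial_le hY hΛ hβ hLY hΨB (hB R₁₂ (Or.inr (Or.inr (Or.inr (Or.inr (Or.inr (Or.inr (Or.inr (Or.inl rfl)))))))))
  have B2213 := abs_Lpow_monomial_le hY hΛ hβ hLY hΨB (hB R₁₃ (Or.inr (Or.inr (Or.inr (Or.inr (Or.inr (Or.inr (Or.inr (Or.inr (Or.inl rfl))))))))))
  have B2410 := abs_Lpow_monomial_le hY hΛ hβ hLY hΨBD (hBD R₁₀ (Or.inr (Or.inr (Or.inr (Or.inl rfl)))))
  have B2411 := abs_Lpow_monomial_le hY hΛ hβ hLY hΨBD (hBD R₁₁ (Or.inr (Or.inr (Or.inr (Or.inr (Or.inl rfl))))))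
  have g1 := U10 7 m₁ m₂ hm₁ hm₂
  have g2 := C210 5 m₁ m₂ hm₁ hm₂
  have g3 := C210 5 m₂ m₁ hm₂ hm₁
  have g4 := C410 3 m₁ m₂ hm₁ hm₂
  have g5 := B2210 3 m₁ m₂ hm₁ hm₂
  have g6 := C410 3 m₂ m₁ hm₂ hm₁
  have g7 := C610 1 m₁ m₂ hm₁ hm₂
  have g8 := B2410 1 m₁ m₂ hm₁ hm₂
  have g9 := B2410 1 m₂ m₁ hm₂ hm₁
  have g10 := C610 1 m₂ m₁ hm₂ hm₁
  have g11 := U11 6 m₁ m₂ hm₁ hm₂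
  have g12 := C211 4 m₁ m₂ hm₁ hm₂
  have g13 := C211 4 m₂ m₁ hm₂ hm₁
  have g14 := C411 2 m₁ m₂ hm₁ hm₂
  have g15 := B2211 2 m₁ m₂ hm₁ hm₂
  have g16 := C411 2 m₂ m₁ hm₂ hm₁
  have g17 := C611 0 m₁ m₂ hm₁ hm₂
  have g18 := B2411 0 m₁ m₂ hm₁ hm₂
  have g19 := B2411 0 m₂ m₁ hm₂ hm₁
  have g20 := C611 0 m₂ m₁ hm₂ hm₁
  have g21 := U12 5 m₁ m₂ hm₁ hm₂
  have g22 := C212 3 m₁ m₂ hm₁ hm₂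
  have g23 := C212 3 m₂ m₁ hm₂ hm₁
  have g24 := C412 1 m₁ m₂ hm₁ hm₂
  have g25 := B2212 1 m₁ m₂ hm₁ hm₂
  have g26 := C412 1 m₂ m₁ hm₂ hm₁
  have g27 := U13 4 m₁ m₂ hm₁ hm₂
  have g28 := C413 0 m₁ m₂ hm₁ hm₂
  have g29 := B2213 0 m₁ m₂ hm₁ hm₂
  have g30 := C413 0 m₂ m₁ hm₂ hm₁
  have g31 := U14 3 m₁ m₂ hm₁ hm₂
  have g32 := C214 1 m₁ m₂ hm₁ hm₂
  have g33 := C214 1 m₂ m₁ hm₂ hm₁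
  rw [show m₂ + m₁ = m₁ + m₂ from add_comm _ _] at g3 g6 g9 g10 g13 g16 g19 g20 g23 g26 g30 g33
  rw [← hI] at g1 g2 g3 g4 g5 g6 g7 g8 g9 g10 g11 g12 g13 g14 g15 g16 g17 g18 g19 g20 g21 g22 g23 g24 g25 g26 g27 g28 g29 g30 g31 g32 g33
  simp only [← hX₀, ← hX₂, ← hX₄, ← hX₆, ← hXB, ← hXBD] at g1 g2 g3 g4 g5 g6 g7 g8 g9 g10 g11 g12 g13 g14 g15 g16 g17 g18 g19 g20 g21 g22 g23 g24 g25 g26 g27 g28 g29 g30 g31 g32 g33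
  -- the decomposition of this part of the weight into 33 terms
  have hid : ∑ k₁ ∈ I, ∑ k₂ ∈ I,
      a k₁ * a k₂ * ellp Y k₁ ^ m₁ * ellp Y k₂ ^ m₂ *
        (((2 * β + ellp Y k₁ + ellp Y k₂) ^ 7 - 3 * (2 * β + ellp Y k₁ + ellp Y k₂) ^ 5 * (P2 k₁ + P2 k₂) + 9 * (2 * β + ellp Y k₁ + ellp Y k₂) ^ 3 * (P2 k₁ + P2 k₂) ^ 2 - 15 * (2 * β + ellp Y k₁ + ellp Y k₂) * (P2 k₁ + P2 k₂) ^ 3 - 6 * (2 * β + ellp Y k₁ + ellp Y k₂) ^ 3 * (P4 k₁ + P4 k₂) + 30 * (2 * β + ellp Y k₁ + ellp Y k₂) * (P2 k₁ + P2 k₂) * (P4 k₁ + P4 k₂) - 16 * (2 * β + ellp Y k₁ + ellp Y k₂) * (P6 k₁ + P6 k₂)) / 32 * R₁₀ (α * k₁ * k₂) +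
            ((2 * β + ellp Y k₁ + ellp Y k₂) ^ 6 - 3 * (2 * β + ellp Y k₁ + ellp Y k₂) ^ 4 * (P2 k₁ + P2 k₂) + 9 * (2 * β + ellp Y k₁ + ellp Y k₂) ^ 2 * (P2 k₁ + P2 k₂) ^ 2 - 6 * (2 * β + ellp Y k₁ + ellp Y k₂) ^ 2 * (P4 k₁ + P4 k₂) - 15 * (P2 k₁ + P2 k₂) ^ 3 + 30 * (P2 k₁ + P2 k₂) * (P4 k₁ + P4 k₂) - 16 * (P6 k₁ + P6 k₂)) / 4 * R₁₁ (α * k₁ * k₂) +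
            (3 * (2 * β + ellp Y k₁ + ellp Y k₂) ^ 5 - 6 * (2 * β + ellp Y k₁ + ellp Y k₂) ^ 3 * (P2 k₁ + P2 k₂) + 9 * (2 * β + ellp Y k₁ + ellp Y k₂) * (P2 k₁ + P2 k₂) ^ 2 - 6 * (2 * β + ellp Y k₁ + ellp Y k₂) * (P4 k₁ + P4 k₂)) / 4 * R₁₂ (α * k₁ * k₂) +
            ((2 * β + ellp Y k₁ + ellp Y k₂) ^ 4 - 3 * (P2 k₁ + P2 k₂) ^ 2 + 2 * (P4 k₁ + P4 k₂)) * R₁₃ (α * k₁ * k₂) +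
            ((2 * β + ellp Y k₁ + ellp Y k₂) ^ 3 + 3 * (2 * β + ellp Y k₁ + ellp Y k₂) * (P2 k₁ + P2 k₂)) / 2 * R₁₄ (α * k₁ * k₂)) =
      1 / 32 * ∑ k₁ ∈ I, ∑ k₂ ∈ I, a k₁ * a k₂ * ellp Y k₁ ^ m₁ * ellp Y k₂ ^ m₂ * ((2 * β + ellp Y k₁ + ellp Y k₂) ^ 7 * R₁₀ (α * k₁ * k₂)) -
      3 / 32 * ∑ k₁ ∈ I, ∑ k₂ ∈ I, a k₁ * (a k₂ * P2 k₂) * ellp Y k₁ ^ m₁ * ellp Y k₂ ^ m₂ * ((2 * β + ellp Y k₁ + ellp Y k₂) ^ 5 * R₁₀ (α * k₁ * k₂)) -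
      3 / 32 * ∑ k₁ ∈ I, ∑ k₂ ∈ I, a k₁ * P2 k₁ * a k₂ * ellp Y k₁ ^ m₁ * ellp Y k₂ ^ m₂ * ((2 * β + ellp Y k₁ + ellp Y k₂) ^ 5 * R₁₀ (α * k₁ * k₂)) +
      3 / 32 * ∑ k₁ ∈ I, ∑ k₂ ∈ I, a k₁ * (a k₂ * (3 * P2 k₂ ^ 2 - 2 * P4 k₂)) * ellp Y k₁ ^ m₁ * ellp Y k₂ ^ m₂ * ((2 * β + ellp Y k₁ + ellp Y k₂) ^ 3 * R₁₀ (α * k₁ * k₂)) +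
      9 / 16 * ∑ k₁ ∈ I, ∑ k₂ ∈ I, (a k₁ * P2 k₁) * (a k₂ * P2 k₂) * ellp Y k₁ ^ m₁ * ellp Y k₂ ^ m₂ * ((2 * β + ellp Y k₁ + ellp Y k₂) ^ 3 * R₁₀ (α * k₁ * k₂)) +
      3 / 32 * ∑ k₁ ∈ I, ∑ k₂ ∈ I, a k₁ * (3 * P2 k₁ ^ 2 - 2 * P4 k₁) * a k₂ * ellp Y k₁ ^ m₁ * ellp Y k₂ ^ m₂ * ((2 * β + ellp Y k₁ + ellp Y k₂) ^ 3 * R₁₀ (α * k₁ * k₂)) -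
      1 / 32 * ∑ k₁ ∈ I, ∑ k₂ ∈ I, a k₁ * (a k₂ * (15 * P2 k₂ ^ 3 - 30 * P2 k₂ * P4 k₂ + 16 * P6 k₂)) * ellp Y k₁ ^ m₁ * ellp Y k₂ ^ m₂ * ((2 * β + ellp Y k₁ + ellp Y k₂) ^ 1 * R₁₀ (α * k₁ * k₂)) -
      15 / 32 * ∑ k₁ ∈ I, ∑ k₂ ∈ I, (a k₁ * P2 k₁) * (a k₂ * (3 * P2 k₂ ^ 2 - 2 * P4 k₂)) * ellp Y k₁ ^ m₁ * ellp Y k₂ ^ m₂ * ((2 * β + ellp Y k₁ + ellp Y k₂) ^ 1 * R₁₀ (α * k₁ * k₂)) -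
      15 / 32 * ∑ k₁ ∈ I, ∑ k₂ ∈ I, (a k₁ * (3 * P2 k₁ ^ 2 - 2 * P4 k₁)) * (a k₂ * P2 k₂) * ellp Y k₁ ^ m₁ * ellp Y k₂ ^ m₂ * ((2 * β + ellp Y k₁ + ellp Y k₂) ^ 1 * R₁₀ (α * k₁ * k₂)) -
      1 / 32 * ∑ k₁ ∈ I, ∑ k₂ ∈ I, a k₁ * (15 * P2 k₁ ^ 3 - 30 * P2 k₁ * P4 k₁ + 16 * P6 k₁) * a k₂ * ellp Y k₁ ^ m₁ * ellp Y k₂ ^ m₂ * ((2 * β + ellp Y k₁ + ellp Y k₂) ^ 1 * R₁₀ (α * k₁ * k₂)) +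
      1 / 4 * ∑ k₁ ∈ I, ∑ k₂ ∈ I, a k₁ * a k₂ * ellp Y k₁ ^ m₁ * ellp Y k₂ ^ m₂ * ((2 * β + ellp Y k₁ + ellp Y k₂) ^ 6 * R₁₁ (α * k₁ * k₂)) -
      3 / 4 * ∑ k₁ ∈ I, ∑ k₂ ∈ I, a k₁ * (a k₂ * P2 k₂) * ellp Y k₁ ^ m₁ * ellp Y k₂ ^ m₂ * ((2 * β + ellp Y k₁ + ellp Y k₂) ^ 4 * R₁₁ (α * k₁ * k₂)) -
      3 / 4 * ∑ k₁ ∈ I, ∑ k₂ ∈ I, a k₁ * P2 k₁ * a k₂ * ellp Y k₁ ^ m₁ * ellp Y k₂ ^ m₂ * ((2 * β + ellp Y k₁ + ellp Y k₂) ^ 4 * R₁₁ (α * k₁ * k₂)) +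
      3 / 4 * ∑ k₁ ∈ I, ∑ k₂ ∈ I, a k₁ * (a k₂ * (3 * P2 k₂ ^ 2 - 2 * P4 k₂)) * ellp Y k₁ ^ m₁ * ellp Y k₂ ^ m₂ * ((2 * β + ellp Y k₁ + ellp Y k₂) ^ 2 * R₁₁ (α * k₁ * k₂)) +
      9 / 2 * ∑ k₁ ∈ I, ∑ k₂ ∈ I, (a k₁ * P2 k₁) * (a k₂ * P2 k₂) * ellp Y k₁ ^ m₁ * ellp Y k₂ ^ m₂ * ((2 * β + ellp Y k₁ + ellp Y k₂) ^ 2 * R₁₁ (α * k₁ * k₂)) +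
      3 / 4 * ∑ k₁ ∈ I, ∑ k₂ ∈ I, a k₁ * (3 * P2 k₁ ^ 2 - 2 * P4 k₁) * a k₂ * ellp Y k₁ ^ m₁ * ellp Y k₂ ^ m₂ * ((2 * β + ellp Y k₁ + ellp Y k₂) ^ 2 * R₁₁ (α * k₁ * k₂)) -
      1 / 4 * ∑ k₁ ∈ I, ∑ k₂ ∈ I, a k₁ * (a k₂ * (15 * P2 k₂ ^ 3 - 30 * P2 k₂ * P4 k₂ + 16 * P6 k₂)) * ellp Y k₁ ^ m₁ * ellp Y k₂ ^ m₂ * ((2 * β + ellp Y k₁ + ellp Y k₂) ^ 0 * R₁₁ (α * k₁ * k₂)) -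
      15 / 4 * ∑ k₁ ∈ I, ∑ k₂ ∈ I, (a k₁ * P2 k₁) * (a k₂ * (3 * P2 k₂ ^ 2 - 2 * P4 k₂)) * ellp Y k₁ ^ m₁ * ellp Y k₂ ^ m₂ * ((2 * β + ellp Y k₁ + ellp Y k₂) ^ 0 * R₁₁ (α * k₁ * k₂)) -
      15 / 4 * ∑ k₁ ∈ I, ∑ k₂ ∈ I, (a k₁ * (3 * P2 k₁ ^ 2 - 2 * P4 k₁)) * (a k₂ * P2 k₂) * ellp Y k₁ ^ m₁ * ellp Y k₂ ^ m₂ * ((2 * β + ellp Y k₁ + ellp Y k₂) ^ 0 * R₁₁ (α * k₁ * k₂)) -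
      1 / 4 * ∑ k₁ ∈ I, ∑ k₂ ∈ I, a k₁ * (15 * P2 k₁ ^ 3 - 30 * P2 k₁ * P4 k₁ + 16 * P6 k₁) * a k₂ * ellp Y k₁ ^ m₁ * ellp Y k₂ ^ m₂ * ((2 * β + ellp Y k₁ + ellp Y k₂) ^ 0 * R₁₁ (α * k₁ * k₂)) +
      3 / 4 * ∑ k₁ ∈ I, ∑ k₂ ∈ I, a k₁ * a k₂ * ellp Y k₁ ^ m₁ * ellp Y k₂ ^ m₂ * ((2 * β + ellp Y k₁ + ellp Y k₂) ^ 5 * R₁₂ (α * k₁ * k₂)) -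
      3 / 2 * ∑ k₁ ∈ I, ∑ k₂ ∈ I, a k₁ * (a k₂ * P2 k₂) * ellp Y k₁ ^ m₁ * ellp Y k₂ ^ m₂ * ((2 * β + ellp Y k₁ + ellp Y k₂) ^ 3 * R₁₂ (α * k₁ * k₂)) -
      3 / 2 * ∑ k₁ ∈ I, ∑ k₂ ∈ I, a k₁ * P2 k₁ * a k₂ * ellp Y k₁ ^ m₁ * ellp Y k₂ ^ m₂ * ((2 * β + ellp Y k₁ + ellp Y k₂) ^ 3 * R₁₂ (α * k₁ * k₂)) +
      3 / 4 * ∑ k₁ ∈ I, ∑ k₂ ∈ I, a k₁ * (a k₂ * (3 * P2 k₂ ^ 2 - 2 * P4 k₂)) * ellp Y k₁ ^ m₁ * ellp Y k₂ ^ m₂ * ((2 * β + ellp Y k₁ + ellp Y k₂) ^ 1 * R₁₂ (α * k₁ * k₂)) +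
      9 / 2 * ∑ k₁ ∈ I, ∑ k₂ ∈ I, (a k₁ * P2 k₁) * (a k₂ * P2 k₂) * ellp Y k₁ ^ m₁ * ellp Y k₂ ^ m₂ * ((2 * β + ellp Y k₁ + ellp Y k₂) ^ 1 * R₁₂ (α * k₁ * k₂)) +
      3 / 4 * ∑ k₁ ∈ I, ∑ k₂ ∈ I, a k₁ * (3 * P2 k₁ ^ 2 - 2 * P4 k₁) * a k₂ * ellp Y k₁ ^ m₁ * ellp Y k₂ ^ m₂ * ((2 * β + ellp Y k₁ + ellp Y k₂) ^ 1 * R₁₂ (α * k₁ * k₂)) +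
      1 * ∑ k₁ ∈ I, ∑ k₂ ∈ I, a k₁ * a k₂ * ellp Y k₁ ^ m₁ * ellp Y k₂ ^ m₂ * ((2 * β + ellp Y k₁ + ellp Y k₂) ^ 4 * R₁₃ (α * k₁ * k₂)) -
      1 * ∑ k₁ ∈ I, ∑ k₂ ∈ I, a k₁ * (a k₂ * (3 * P2 k₂ ^ 2 - 2 * P4 k₂)) * ellp Y k₁ ^ m₁ * ellp Y k₂ ^ m₂ * ((2 * β + ellp Y k₁ + ellp Y k₂) ^ 0 * R₁₃ (α * k₁ * k₂)) -
      6 * ∑ k₁ ∈ I, ∑ k₂ ∈ I, (a k₁ * P2 k₁) * (a k₂ * P2 k₂) * ellp Y k₁ ^ m₁ * ellp Y k₂ ^ m₂ * ((2 * β + ellp Y k₁ + ellp Y k₂) ^ 0 * R₁₃ (α * k₁ * k₂)) -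
      1 * ∑ k₁ ∈ I, ∑ k₂ ∈ I, a k₁ * (3 * P2 k₁ ^ 2 - 2 * P4 k₁) * a k₂ * ellp Y k₁ ^ m₁ * ellp Y k₂ ^ m₂ * ((2 * β + ellp Y k₁ + ellp Y k₂) ^ 0 * R₁₃ (α * k₁ * k₂)) +
      1 / 2 * ∑ k₁ ∈ I, ∑ k₂ ∈ I, a k₁ * a k₂ * ellp Y k₁ ^ m₁ * ellp Y k₂ ^ m₂ * ((2 * β + ellp Y k₁ + ellp Y k₂) ^ 3 * R₁₄ (α * k₁ * k₂)) +
      3 / 2 * ∑ k₁ ∈ I, ∑ k₂ ∈ I, a k₁ * (a k₂ * P2 k₂) * ellp Y k₁ ^ m₁ * ellp Y k₂ ^ m₂ * ((2 * β + ellp Y k₁ + ellp Y k₂) ^ 1 * R₁₄ (α * k₁ * k₂)) +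
      3 / 2 * ∑ k₁ ∈ I, ∑ k₂ ∈ I, a k₁ * P2 k₁ * a k₂ * ellp Y k₁ ^ m₁ * ellp Y k₂ ^ m₂ * ((2 * β + ellp Y k₁ + ellp Y k₂) ^ 1 * R₁₄ (α * k₁ * k₂)) := by
    simp (maxSteps := 4000000) only [Finset.mul_sum, ← Finset.sum_add_distrib, ← Finset.sum_sub_distrib]
    refine Finset.sum_congr rfl fun k₁ _ ↦ Finset.sum_congr rfl fun k₂ _ ↦ ?_
    ring
  rw [hid]
  -- move the row decorations to the column
  have hsw1 : ∑ k₁ ∈ I, ∑ k₂ ∈ I, a k₁ * P2 k₁ * a k₂ * ellp Y k₁ ^ m₁ * ellp Y k₂ ^ m₂ * ((2 * β + ellp Y k₁ + ellp Y k₂) ^ 5 * R₁₀ (α * k₁ * k₂)) =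
      ∑ k₁ ∈ I, ∑ k₂ ∈ I, a k₁ * (a k₂ * P2 k₂) * ellp Y k₁ ^ m₂ * ellp Y k₂ ^ m₁ * ((2 * β + ellp Y k₁ + ellp Y k₂) ^ 5 * R₁₀ (α * k₁ * k₂)) := sum_swap_decor_Lpow a P2 R₁₀ Y α β m₁ m₂ 5 I
  have hsw2 : ∑ k₁ ∈ I, ∑ k₂ ∈ I, a k₁ * (3 * P2 k₁ ^ 2 - 2 * P4 k₁) * a k₂ * ellp Y k₁ ^ m₁ * ellp Y k₂ ^ m₂ * ((2 * β + ellp Y k₁ + ellp Y k₂) ^ 3 * R₁₀ (α * k₁ * k₂)) =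
      ∑ k₁ ∈ I, ∑ k₂ ∈ I, a k₁ * (a k₂ * (3 * P2 k₂ ^ 2 - 2 * P4 k₂)) * ellp Y k₁ ^ m₂ * ellp Y k₂ ^ m₁ * ((2 * β + ellp Y k₁ + ellp Y k₂) ^ 3 * R₁₀ (α * k₁ * k₂)) := sum_swap_decor_Lpow a (fun k ↦ 3 * P2 k ^ 2 - 2 * P4 k) R₁₀ Y α β m₁ m₂ 3 I
  have hsw3 : ∑ k₁ ∈ I, ∑ k₂ ∈ I, (a k₁ * (3 * P2 k₁ ^ 2 - 2 * P4 k₁)) * (a k₂ * P2 k₂) * ellp Y k₁ ^ m₁ * ellp Y k₂ ^ m₂ * ((2 * β + ellp Y k₁ + ellp Y k₂) ^ 1 * R₁₀ (α * k₁ * k₂)) =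
      ∑ k₁ ∈ I, ∑ k₂ ∈ I, (a k₁ * P2 k₁) * (a k₂ * (3 * P2 k₂ ^ 2 - 2 * P4 k₂)) * ellp Y k₁ ^ m₂ * ellp Y k₂ ^ m₁ * ((2 * β + ellp Y k₁ + ellp Y k₂) ^ 1 * R₁₀ (α * k₁ * k₂)) := sum_swap_both_Lpow a (fun k ↦ 3 * P2 k ^ 2 - 2 * P4 k) P2 R₁₀ Y α β m₁ m₂ 1 I
  have hsw4 : ∑ k₁ ∈ I, ∑ k₂ ∈ I, a k₁ * (15 * P2 k₁ ^ 3 - 30 * P2 k₁ * P4 k₁ + 16 * P6 k₁) * a k₂ * ellp Y k₁ ^ m₁ * ellp Y k₂ ^ m₂ * ((2 * β + ellp Y k₁ + ellp Y k₂) ^ 1 * R₁₀ (α * k₁ * k₂)) =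
      ∑ k₁ ∈ I, ∑ k₂ ∈ I, a k₁ * (a k₂ * (15 * P2 k₂ ^ 3 - 30 * P2 k₂ * P4 k₂ + 16 * P6 k₂)) * ellp Y k₁ ^ m₂ * ellp Y k₂ ^ m₁ * ((2 * β + ellp Y k₁ + ellp Y k₂) ^ 1 * R₁₀ (α * k₁ * k₂)) := sum_swap_decor_Lpow a (fun k ↦ 15 * P2 k ^ 3 - 30 * P2 k * P4 k + 16 * P6 k) R₁₀ Y α β m₁ m₂ 1 I
  have hsw5 : ∑ k₁ ∈ I, ∑ k₂ ∈ I, a k₁ * P2 k₁ * a k₂ * ellp Y k₁ ^ m₁ * ellp Y k₂ ^ m₂ * ((2 * β + ellp Y k₁ + ellp Y k₂) ^ 4 * R₁₁ (α * k₁ * k₂)) =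
      ∑ k₁ ∈ I, ∑ k₂ ∈ I, a k₁ * (a k₂ * P2 k₂) * ellp Y k₁ ^ m₂ * ellp Y k₂ ^ m₁ * ((2 * β + ellp Y k₁ + ellp Y k₂) ^ 4 * R₁₁ (α * k₁ * k₂)) := sum_swap_decor_Lpow a P2 R₁₁ Y α β m₁ m₂ 4 I
  have hsw6 : ∑ k₁ ∈ I, ∑ k₂ ∈ I, a k₁ * (3 * P2 k₁ ^ 2 - 2 * P4 k₁) * a k₂ * ellp Y k₁ ^ m₁ * ellp Y k₂ ^ m₂ * ((2 * β + ellp Y k₁ + ellp Y k₂) ^ 2 * R₁₁ (α * k₁ * k₂)) =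
      ∑ k₁ ∈ I, ∑ k₂ ∈ I, a k₁ * (a k₂ * (3 * P2 k₂ ^ 2 - 2 * P4 k₂)) * ellp Y k₁ ^ m₂ * ellp Y k₂ ^ m₁ * ((2 * β + ellp Y k₁ + ellp Y k₂) ^ 2 * R₁₁ (α * k₁ * k₂)) := sum_swap_decor_Lpow a (fun k ↦ 3 * P2 k ^ 2 - 2 * P4 k) R₁₁ Y α β m₁ m₂ 2 I
  have hsw7 : ∑ k₁ ∈ I, ∑ k₂ ∈ I, (a k₁ * (3 * P2 k₁ ^ 2 - 2 * P4 k₁)) * (a k₂ * P2 k₂) * ellp Y k₁ ^ m₁ * ellp Y k₂ ^ m₂ * ((2 * β + ellp Y k₁ + ellp Y k₂) ^ 0 * R₁₁ (α * k₁ * k₂)) =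
      ∑ k₁ ∈ I, ∑ k₂ ∈ I, (a k₁ * P2 k₁) * (a k₂ * (3 * P2 k₂ ^ 2 - 2 * P4 k₂)) * ellp Y k₁ ^ m₂ * ellp Y k₂ ^ m₁ * ((2 * β + ellp Y k₁ + ellp Y k₂) ^ 0 * R₁₁ (α * k₁ * k₂)) := sum_swap_both_Lpow a (fun k ↦ 3 * P2 k ^ 2 - 2 * P4 k) P2 R₁₁ Y α β m₁ m₂ 0 I
  have hsw8 : ∑ k₁ ∈ I, ∑ k₂ ∈ I, a k₁ * (15 * P2 k₁ ^ 3 - 30 * P2 k₁ * P4 k₁ + 16 * P6 k₁) * a k₂ * ellp Y k₁ ^ m₁ * ellp Y k₂ ^ m₂ * ((2 * β + ellp Y k₁ + ellp Y k₂) ^ 0 * R₁₁ (α * k₁ * k₂)) =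
      ∑ k₁ ∈ I, ∑ k₂ ∈ I, a k₁ * (a k₂ * (15 * P2 k₂ ^ 3 - 30 * P2 k₂ * P4 k₂ + 16 * P6 k₂)) * ellp Y k₁ ^ m₂ * ellp Y k₂ ^ m₁ * ((2 * β + ellp Y k₁ + ellp Y k₂) ^ 0 * R₁₁ (α * k₁ * k₂)) := sum_swap_decor_Lpow a (fun k ↦ 15 * P2 k ^ 3 - 30 * P2 k * P4 k + 16 * P6 k) R₁₁ Y α β m₁ m₂ 0 I
  have hsw9 : ∑ k₁ ∈ I, ∑ k₂ ∈ I, a k₁ * P2 k₁ * a k₂ * ellp Y k₁ ^ m₁ * ellp Y k₂ ^ m₂ * ((2 * β + ellp Y k₁ + ellp Y k₂) ^ 3 * R₁₂ (α * k₁ * k₂)) =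
      ∑ k₁ ∈ I, ∑ k₂ ∈ I, a k₁ * (a k₂ * P2 k₂) * ellp Y k₁ ^ m₂ * ellp Y k₂ ^ m₁ * ((2 * β + ellp Y k₁ + ellp Y k₂) ^ 3 * R₁₂ (α * k₁ * k₂)) := sum_swap_decor_Lpow a P2 R₁₂ Y α β m₁ m₂ 3 I
  have hsw10 : ∑ k₁ ∈ I, ∑ k₂ ∈ I, a k₁ * (3 * P2 k₁ ^ 2 - 2 * P4 k₁) * a k₂ * ellp Y k₁ ^ m₁ * ellp Y k₂ ^ m₂ * ((2 * β + ellp Y k₁ + ellp Y k₂) ^ 1 * R₁₂ (α * k₁ * k₂)) =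
      ∑ k₁ ∈ I, ∑ k₂ ∈ I, a k₁ * (a k₂ * (3 * P2 k₂ ^ 2 - 2 * P4 k₂)) * ellp Y k₁ ^ m₂ * ellp Y k₂ ^ m₁ * ((2 * β + ellp Y k₁ + ellp Y k₂) ^ 1 * R₁₂ (α * k₁ * k₂)) := sum_swap_decor_Lpow a (fun k ↦ 3 * P2 k ^ 2 - 2 * P4 k) R₁₂ Y α β m₁ m₂ 1 I
  have hsw11 : ∑ k₁ ∈ I, ∑ k₂ ∈ I, a k₁ * (3 * P2 k₁ ^ 2 - 2 * P4 k₁) * a k₂ * ellp Y k₁ ^ m₁ * ellp Y k₂ ^ m₂ * ((2 * β + ellp Y k₁ + ellp Y k₂) ^ 0 * R₁₃ (α * k₁ * k₂)) =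
      ∑ k₁ ∈ I, ∑ k₂ ∈ I, a k₁ * (a k₂ * (3 * P2 k₂ ^ 2 - 2 * P4 k₂)) * ellp Y k₁ ^ m₂ * ellp Y k₂ ^ m₁ * ((2 * β + ellp Y k₁ + ellp Y k₂) ^ 0 * R₁₃ (α * k₁ * k₂)) := sum_swap_decor_Lpow a (fun k ↦ 3 * P2 k ^ 2 - 2 * P4 k) R₁₃ Y α β m₁ m₂ 0 I
  have hsw12 : ∑ k₁ ∈ I, ∑ k₂ ∈ I, a k₁ * P2 k₁ * a k₂ * ellp Y k₁ ^ m₁ * ellp Y k₂ ^ m₂ * ((2 * β + ellp Y k₁ + ellp Y k₂) ^ 1 * R₁₄ (α * k₁ * k₂)) =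
      ∑ k₁ ∈ I, ∑ k₂ ∈ I, a k₁ * (a k₂ * P2 k₂) * ellp Y k₁ ^ m₂ * ellp Y k₂ ^ m₁ * ((2 * β + ellp Y k₁ + ellp Y k₂) ^ 1 * R₁₄ (α * k₁ * k₂)) := sum_swap_decor_Lpow a P2 R₁₄ Y α β m₁ m₂ 1 I
  rw [hsw1, hsw2, hsw3, hsw4, hsw5, hsw6,
    hsw7, hsw8, hsw9, hsw10, hsw11, hsw12]
  -- numerics of the prefactors
  have e7 : (4 * Λ) ^ 7 = 16384 * Λ ^ 7 := by ring
  have e6 : (4 * Λ) ^ 6 = 4096 * Λ ^ 6 := by ring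
  have e5 : (4 * Λ) ^ 5 = 1024 * Λ ^ 5 := by ring
  have e4 : (4 * Λ) ^ 4 = 256 * Λ ^ 4 := by ring
  have e3 : (4 * Λ) ^ 3 = 64 * Λ ^ 3 := by ring
  have e2 : (4 * Λ) ^ 2 = 16 * Λ ^ 2 := by ring
  have e1 : (4 * Λ) ^ 1 = 4 * Λ := by ring
  have e0 : (4 * Λ) ^ 0 = 1 := by ring
  rw [e7] at g1
  rw [e6] at g11
  rw [e5] at g2 g3 g21
  rw [e4] at g12 g13 g27
  rw [e3] at g4 g5 g6 g22 g23 g31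
  rw [e2] at g14 g15 g16
  rw [e1] at g7 g8 g9 g10 g24 g25 g26 g32 g33
  rw [e0] at g17 g18 g19 g20 g28 g29 g30
  have hΛ_0_2 : (1 : ℝ) ≤ Λ ^ 2 := one_le_pow₀ hΛ
  have hΛ_0_4 : (1 : ℝ) ≤ Λ ^ 4 := one_le_pow₀ hΛ
  have hΛ_1_2 : Λ ≤ Λ ^ 2 := le_self_pow₀ hΛ (by norm_num)
  have hΛ_1_4 : Λ ≤ Λ ^ 4 := le_self_pow₀ hΛ (by norm_num)
  have hΛ_1_6 : Λ ≤ Λ ^ 6 := le_self_pow₀ hΛ (by norm_num)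
  have hΛ_2_4 : Λ ^ 2 ≤ Λ ^ 4 := pow_le_pow_right₀ hΛ (by norm_num)
  have hΛ_3_4 : Λ ^ 3 ≤ Λ ^ 4 := pow_le_pow_right₀ hΛ (by norm_num)
  have hΛ_3_6 : Λ ^ 3 ≤ Λ ^ 6 := pow_le_pow_right₀ hΛ (by norm_num)
  have hΛ_3_8 : Λ ^ 3 ≤ Λ ^ 8 := pow_le_pow_right₀ hΛ (by norm_num)
  have hΛ_4_6 : Λ ^ 4 ≤ Λ ^ 6 := pow_le_pow_right₀ hΛ (by norm_num)
  have hΛ_4_8 : Λ ^ 4 ≤ Λ ^ 8 := pow_le_pow_right₀ hΛ (by norm_num)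
  have hΛ_5_6 : Λ ^ 5 ≤ Λ ^ 6 := pow_le_pow_right₀ hΛ (by norm_num)
  have hΛ_5_8 : Λ ^ 5 ≤ Λ ^ 8 := pow_le_pow_right₀ hΛ (by norm_num)
  have hΛ_6_8 : Λ ^ 6 ≤ Λ ^ 8 := pow_le_pow_right₀ hΛ (by norm_num)
  have hΛ_7_8 : Λ ^ 7 ≤ Λ ^ 8 := pow_le_pow_right₀ hΛ (by norm_num)
  have kX₀_7 : Λ ^ 7 * X₀ ≤ Λ ^ 8 * X₀ := mul_le_mul_of_nonneg_right hΛ_7_8 hX₀0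
  have kX₀_6 : Λ ^ 6 * X₀ ≤ Λ ^ 8 * X₀ := mul_le_mul_of_nonneg_right hΛ_6_8 hX₀0
  have kX₀_5 : Λ ^ 5 * X₀ ≤ Λ ^ 8 * X₀ := mul_le_mul_of_nonneg_right hΛ_5_8 hX₀0
  have kX₀_4 : Λ ^ 4 * X₀ ≤ Λ ^ 8 * X₀ := mul_le_mul_of_nonneg_right hΛ_4_8 hX₀0
  have kX₀_3 : Λ ^ 3 * X₀ ≤ Λ ^ 8 * X₀ := mul_le_mul_of_nonneg_right hΛ_3_8 hX₀0
  have kX₂_5 : Λ ^ 5 * X₂ ≤ Λ ^ 6 * X₂ := mul_le_mul_of_nonneg_right hΛ_5_6 hX₂0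
  have kX₂_4 : Λ ^ 4 * X₂ ≤ Λ ^ 6 * X₂ := mul_le_mul_of_nonneg_right hΛ_4_6 hX₂0
  have kX₂_3 : Λ ^ 3 * X₂ ≤ Λ ^ 6 * X₂ := mul_le_mul_of_nonneg_right hΛ_3_6 hX₂0
  have kX₂_1 : Λ * X₂ ≤ Λ ^ 6 * X₂ := mul_le_mul_of_nonneg_right hΛ_1_6 hX₂0
  have kX₄_3 : Λ ^ 3 * X₄ ≤ Λ ^ 4 * X₄ := mul_le_mul_of_nonneg_right hΛ_3_4 hX₄0
  have kX₄_2 : Λ ^ 2 * X₄ ≤ Λ ^ 4 * X₄ := mul_le_mul_of_nonneg_right hΛ_2_4 hX₄0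
  have kX₄_1 : Λ * X₄ ≤ Λ ^ 4 * X₄ := mul_le_mul_of_nonneg_right hΛ_1_4 hX₄0
  have kX₄_0 : 1 * X₄ ≤ Λ ^ 4 * X₄ := mul_le_mul_of_nonneg_right hΛ_0_4 hX₄0
  have kX₆_1 : Λ * X₆ ≤ Λ ^ 2 * X₆ := mul_le_mul_of_nonneg_right hΛ_1_2 hX₆0
  have kX₆_0 : 1 * X₆ ≤ Λ ^ 2 * X₆ := mul_le_mul_of_nonneg_right hΛ_0_2 hX₆0
  have kXB_3 : Λ ^ 3 * XB ≤ Λ ^ 4 * XB := mul_le_mul_of_nonneg_right hΛ_3_4 hXB0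
  have kXB_2 : Λ ^ 2 * XB ≤ Λ ^ 4 * XB := mul_le_mul_of_nonneg_right hΛ_2_4 hXB0
  have kXB_1 : Λ * XB ≤ Λ ^ 4 * XB := mul_le_mul_of_nonneg_right hΛ_1_4 hXB0
  have kXB_0 : 1 * XB ≤ Λ ^ 4 * XB := mul_le_mul_of_nonneg_right hΛ_0_4 hXB0
  have kXBD_1 : Λ * XBD ≤ Λ ^ 2 * XBD := mul_le_mul_of_nonneg_right hΛ_1_2 hXBD0
  have kXBD_0 : 1 * XBD ≤ Λ ^ 2 * XBD := mul_le_mul_of_nonneg_right hΛ_0_2 hXBD0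
  have htot : (2592 * Λ ^ 8 * Ψ₀ + 780 * Λ ^ 6 * Ψ₂ + 44 * Λ ^ 4 * Ψ₄ + Λ ^ 2 * Ψ₆ + 132 * Λ ^ 4 * ΨB + 12 * Λ ^ 2 * ΨBD) * Real.log Y ^ (m₁ + m₂) =
      2592 * (Λ ^ 8 * X₀) + 780 * (Λ ^ 6 * X₂) + 44 * (Λ ^ 4 * X₄) + (Λ ^ 2 * X₆) + 132 * (Λ ^ 4 * XB) + 12 * (Λ ^ 2 * XBD) := by
    rw [hX₀, hX₂, hX₄, hX₆, hXB, hXBD]; ring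
  rw [htot]
  rw [abs_le] at g1 g2 g3 g4 g5 g6 g7 g8 g9 g10 g11 g12 g13 g14 g15 g16 g17 g18 g19 g20 g21 g22 g23 g24 g25 g26 g27 g28 g29 g30 g31 g32 g33 ⊢
  constructor <;> linarith [g1.1, g1.2, g2.1, g2.2, g3.1, g3.2, g4.1, g4.2, g5.1, g5.2, g6.1, g6.2, g7.1, g7.2, g8.1, g8.2, g9.1, g9.2, g10.1, g10.2, g11.1, g11.2, g12.1, g12.2, g13.1, g13.2, g14.1, g14.2, g15.1, g15.2, g16.1, g16.2, g17.1, g17.2, g18.1, g18.2, g19.1, g19.2, g20.1, g20.2, g21.1, g21.2, g22.1, g22.2, g23.1, g23.2, g24.1, g24.2, g25.1, g25.2, g26.1, g26.2, g27.1, g27.2, g28.1, g28.2, g29.1, g29.2, g30.1, g30.2, g31.1, g31.2, g32.1, g32.2, g33.1, g33.2, kX₀_7, kX₀_6, kX₀_5, kX₀_4, kX₀_3, kX₂_5, kX₂_4, kX₂_3, kX₂_1, kX₄_3, kX₄_2, kX₄_1, kX₄_0, kX₆_1, kX₆_0, kXB_3, kXB_2, kXB_1, kXB_0, kXBD_1,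 kXBD_0, hX₀0, hX₂0, hX₄0, hX₆0, hXB0, hXBD0]

end Summit.Parity.GeneralizedHardyLittlewood.Theorems.MomentsBeyondDiagonal.DiagCorner

end
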